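import Summits.HodgeConjecture.HodgeConjecture.Theses.HeckePrymWeil
import Summits.HodgeConjecture.HodgeConjecture.Theorems.HeckePrymWeilHeckePrymAnchorsOfStubs
import Summits.HodgeConjecture.HodgeConjecture.Theorems.HeckePrymWeilHeckePrymAnchorsUpgrade
import Summits.HodgeConjecture.HodgeConjecture.Theorems.HeckePrymWeilHeckePrymAnchorsRationalAlongSection
import Summits.HodgeConjecture.HodgeConjecture.Theorems.HeckePrymWeilHyperbolicEightfoldsSqrtMinus7LerayFact
import Literature.AlgebraicGeometry.HodgeTheory.WeilFamilyReach
import Literature.AlgebraicGeometry.HodgeTheory.SemiregularVariationalHodgeFull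
import Literature.AlgebraicGeometry.HodgeTheory.StandardChernCharacterBetti
import Literature.AlgebraicGeometry.HodgeTheory.WeilClassesSixfoldsProofs
import Literature.AlgebraicGeometry.HodgeTheory.WeilTypePeriodPoint
import Literature.AlgebraicGeometry.HodgeTheory.LefschetzOneOneHolds
import Literature.AlgebraicGeometry.HodgeTheory.AlgebraicClassesCupAbelianVariety
import Literature.AlgebraicGeometry.HodgeTheory.IsoTransport
import Literature.AlgebraicGeometry.Motives.AbelianVarietyCohomologyExteriorH1
import Literature.AlgebraicGeometry.Motives.VarietiesGeometricallyIntegralProofs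
import HarnessLib

/-!
# Weil classes on HYPERBOLIC `K`-Weil abelian `2n`-folds from ONE anchor object — the Perry engine at a hyperbolic anchor
# (crux `HeckePrymWeil.HyperbolicEightfoldsSqrtMinus7`, item stmt-HodgeConjecture-14642, route HeckePrymWeil)

Line `euler-squeeze-rank-two-secant-bundle` of the crux (Hodge–Weil classes of every HYPERBOLIC `ℚ(√-7)`-Weil abelian
EIGHTFOLD are algebraic), skeleton v3 (lead c11, 2026-08-17): the composition of the line, kernel-checked and landed as a
CONDITIONAL theorem.  Nothing is asserted: the four hypotheses are exactly the four registered stubs of the skeleton —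

1. `HodgeTheory.weilFamilyReach_hyperbolic` (named fact F, BY NAME): Deligne's polarized Weil family through a hyperbolic
   `(P, ψ, h(e, a))` with relative polarization class `H`, a continuous `(n,n)`-valued Weil section `σ` through any
   non-zero Weil class `w` of `P`, abelian fibre charts, and a `K`-isogeny `A → A' ≅ 𝒳_{s₁}` from EVERY hyperbolic target
   `(A, φ, h(e_A, a_A))` with `σ(s₁)` a non-zero Weil class of `A'`;
2. `HodgeTheory.Perry2026_semiregularFull_remainsAlgebraic` (named fact P, BY NAME, `[claim]`): Perry 2026 Thm. 1.1 (2) with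
   the source's FULL Buchweitz–Flenner semiregularity `IsISemiregular hE₀ Set.univ`;
3. `Nonempty HodgeTheory.StandardChernCharacterBetti` (construction debt C);
4. THE ANCHOR OBJECT (the line's bet O, spelled out verbatim as the hypothesis `hO`; at `(n, d) = (4, 7)` it is the
   skeleton's `SecantAnchorObject47` on the nose): ONE abelian `2n`-fold `(P, ψ)`, `ψ ≫ ψ = -d`, hyperbolic for
   `h(e, a) = d·ι^*a + ψ^*ι^*a`, a non-zero rational class `w` of its strong Weil plane `weilClassesOf P ψ n d`, and on
   every `ℂ`-scheme `F₀ ≅ P.X`, for every standard Chern character theory `C`, a finite locally free SEMIREGULAR `E₀`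
   with `ch_k(E₀) = q_k·h^k` (`k ≠ n`) and `ch_n(E₀) = q_n·h^n + r·w`, `r ∈ ℚˣ`, transported along `e₀ : P.X ≅ F₀`.

Conclusion (`weilClasses_algebraic_of_anchorObject`, every `n, d ≥ 1`): the strong Weil plane of EVERY hyperbolic
`(A, φ, h(e_A, a_A))` of dimension `2n` with `φ ≫ φ = -d` is algebraic; at `(4, 7)`
(`hyperbolicEightfoldsSqrtMinus7_of_anchorObject`) the crux BY NAME, through the landed `stub_upgrade` (typed plane
⊆ strong plane).  MECHANISM (all steps landed elsewhere or proved here): F carries `h(e, a)` as `H` and `w` as the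
section `σ`, which is the restriction of a GLOBAL class `W ∈ H^{2n}(𝒳)` (W-engine `stub_globalClassEngine`,
from Deligne 1968 discharged) and rational along `σ` (`stub_rationalAlongSection`); `engine_of_perry` (proved here)
feeds P the family of sections `s ↦ (q_k·H^k + [k = n]·r·W)|_{𝒳_s}` — continuous because global, valued in Hodge
classes, equal to `ch(E₀)` at `s₀` — so `q_n·H_{s₁}^n + r·W_{s₁}` is algebraic; `H_{s₁}^n` is algebraic (Lefschetz
`(1,1)`, discharged, plus Kleiman on the abelian `A'`: `cupPowTwo_mem_algebraicClasses_abelian`); hence `W_{s₁} = w₁`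
(`r ≠ 0`) is a non-zero algebraic class of the strong Weil plane of `A'`; ONE CLASS SUFFICES
(`weilClassesOf_le_algebraicClasses_iff_exists_ne_zero_of_dim_eq` with `abelianVarietyCohomologyExteriorH1_holds`,
unconditional); isogeny transfer `A → A'` (`stub_isogenyTransfer`, landed).  Hyperbolicity is consumed twice (the
anchor must be hyperbolic for F to apply at it; only hyperbolic targets are reached), as the crux's Disproof §3(e)
demands.  Sibling precedent at a TENSOR anchor, all discriminants: `…WeilTenfoldsSqrtMinus11TensorAnchorPerryFull`.

What any witness of hypothesis 4 must look like is recorded in the crux's `NOTES.md` §8–§10.A (lead c10): WLOG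
indecomposable, no semi-homogeneous summand, first-order deformable along all `n²` Weil directions,
`rank ob = dim HT² - n² ≤ ext²(E₀, E₀)`.  No such untwisted object is known in any dimension (Markman's `n = 3` sheaves
are μ₂-twisted); this file makes precise what it would buy.
-/

noncomputable section

-- single-problem summit (Problem = Summit): the mandated namespace repeats `HodgeConjecture`.
set_option linter.dupNamespace false

open CategoryTheory AlgebraicGeometry Limits MonoidalCategory CartesianMonoidalCategory
open Literature.AlgebraicGeometry Literature.AlgebraicGeometry.Motives
  Literature.AlgebraicGeometry.HodgeTheory
open Literature.AlgebraicTopology.SingularHomology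
open Summit.HodgeConjecture.HodgeConjecture.Theorems.HeckePrymWeilLine
  (stub_upgrade stub_rationalAlongSection stub_isogenyTransfer owf_isoTransport)
open Summit.HodgeConjecture.HodgeConjecture.Theorems.HyperbolicEightfoldsSqrtMinus7.TensorAnchor
  (stub_globalClassEngine)

namespace Summit.HodgeConjecture.HodgeConjecture.Theorems.HyperbolicEightfoldsSqrtMinus7.AnchorObject

/-! ## Infrastructure -/

/-- Naturality of cup powers for pull-backs along scheme morphisms: `g^*(x^i) = (g^*x)^i`.
[cite: HatcherAT2002, Prop. 3.10] -/
theorem complexBetti_map_cupPowTwo {X' X : SchemeOver ℂ} (g : X' ⟶ X) (x : complexBetti X 2) (i : ℕ) :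
    complexBetti.map g (2 * i) (cupPowTwo x i) = cupPowTwo (complexBetti.map g 2 x) i :=
  map_cupPowTwo _ x i

/-- **Powers of divisor classes on an abelian variety are algebraic**: `x ∈ N¹H² ⟹ x^{i+1} ∈ N^{i+1}H^{2i+2}`
(Kleiman moving by translations — the tree's `AbelianVariety.cupProduct_mem_algebraicClasses_one` — iterated).
[cite: VoisinHodgeII2003, §9.2.4 Prop. 9.20] -/
theorem cupPowTwo_mem_algebraicClasses_abelian (A : AbelianVariety ℂ) {x : complexBetti A.X 2}
    (hx : x ∈ algebraicClasses A.X 1) : ∀ i : ℕ, cupPowTwo x (i + 1) ∈ algebraicClasses A.X (i + 1)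
  | 0 => by rw [cupPowTwo_one]; exact hx
  | i + 1 => by
    rw [cupPowTwo_succ]
    exact AbelianVariety.cupProduct_mem_algebraicClasses_one A (cupPowTwo_mem_algebraicClasses_abelian A hx i) hx

/-! ## The engine step, PROVED from Perry's fact -/

/-- **ENGINE (Perry ⟹ the impure Weil section is algebraic on EVERY fibre).**  Along a smooth projective family
`f : 𝒳 ⟶ S` of relative dimension `2n` over a smooth irreducible quasi-projective base, let `H ∈ H²(𝒳)` have
rational `(1,1)` restrictions and `W ∈ H^{2n}(𝒳)` rational `(n,n)` restrictions.  If at ONE point `s₀` there is a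
finite locally free SEMIREGULAR `E₀` on the fibre with `ch_k(E₀) = q_k·H_{s₀}^k` (`k ≠ n`) and
`ch_n(E₀) = q_n·H_{s₀}^n + W_{s₀}` in some Chern character theory `C`, then `q_n·H_s^n + W_s` is ALGEBRAIC on
`𝒳_s` for EVERY `s`: Perry's theorem applied to the family of sections `s ↦ (q_k·H^k + [k = n]·W)|_{𝒳_s}` —
continuous because they are restrictions of GLOBAL classes (`continuous_globalSection`), valued in the locus of
Hodge classes (`IsRationalClass.cupPowTwo`, `isOfHodgeType_cupPowTwo`), equal to `ch(E₀)` at `s₀`.  The base is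
integral, being smooth (hence reduced) and irreducible. [cite: Perry2026Semiregularity, Thm. 1.1 (2)]
[cite: BuchweitzFlenner2003, Thm. 5.1] -/
theorem engine_of_perry (hP : Perry2026_semiregularFull_remainsAlgebraic) (n : ℕ)
    {𝒳 S : SchemeOver ℂ} (f : 𝒳 ⟶ S) (hf : IsSmoothProjectiveFamily f (2 * n))
    (hirr : IrreducibleSpace S.left) (hS : AlgebraicGeometry.Smooth S.hom) (hSqp : IsQuasiProjectiveOver S)
    (H : complexBetti 𝒳 2)
    (hH : ∀ s, IsRationalClass (complexBetti.map (fiberι f s) 2 H) ∧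
      IsOfHodgeType (2 * n) (fiberOver f s) 2 1 1 (complexBetti.map (fiberι f s) 2 H))
    (W : complexBetti 𝒳 (2 * n))
    (hWrat : ∀ s, IsRationalClass (complexBetti.map (fiberι f s) (2 * n) W))
    (hWH : ∀ s, IsOfHodgeType (2 * n) (fiberOver f s) (2 * n) n n (complexBetti.map (fiberι f s) (2 * n) W))
    (s₀ : ComplexPoints S) (C : ChernCharacterBetti) (E₀ : (fiberOver f s₀).left.Modules)
    (hE₀ : IsFiniteLocallyFree E₀) (hsr : IsISemiregular hE₀ Set.univ) (q : ℕ → ℚ)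
    (hk : ∀ k : ℕ, k ≠ n →
      C.ch (fiberOver f s₀) E₀ k = ((q k : ℚ) : ℂ) • cupPowTwo (complexBetti.map (fiberι f s₀) 2 H) k)
    (hn : C.ch (fiberOver f s₀) E₀ n =
      ((q n : ℚ) : ℂ) • cupPowTwo (complexBetti.map (fiberι f s₀) 2 H) n +
        complexBetti.map (fiberι f s₀) (2 * n) W) :
    ∀ s : ComplexPoints S,
      ((q n : ℚ) : ℂ) • cupPowTwo (complexBetti.map (fiberι f s) 2 H) n +
          complexBetti.map (fiberι f s) (2 * n) W ∈ algebraicClasses (fiberOver f s) n := by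
  intro s
  haveI := hS
  haveI := hirr
  haveI : IsReduced S.left := isReduced_of_smooth_over_field S.hom
  have hint : IsIntegral S.left := isIntegral_of_irreducibleSpace_of_isReduced _
  -- the global classes `A k = q_k • H^k + [k = n] • W` on the total space
  let A : ∀ k : ℕ, complexBetti 𝒳 (2 * k) := fun k =>
    if h : k = n then ((q k : ℚ) : ℂ) • cupPowTwo H k + h ▸ W else ((q k : ℚ) : ℂ) • cupPowTwo H k
  have hAn : A n = ((q n : ℚ) : ℂ) • cupPowTwo H n + W := by
    show (if h : n = n then _ else _) = _
    rw [dif_pos rfl]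
  have hAk : ∀ k, k ≠ n → A k = ((q k : ℚ) : ℂ) • cupPowTwo H k := by
    intro k hk'
    show (if h : k = n then _ else _) = _
    rw [dif_neg hk']
  -- restrictions of the global classes to the fibres
  have hres : ∀ k s, complexBetti.map (fiberι f s) (2 * k) (((q k : ℚ) : ℂ) • cupPowTwo H k) =
      ((q k : ℚ) : ℂ) • cupPowTwo (complexBetti.map (fiberι f s) 2 H) k := by
    intro k s
    rw [map_smul, complexBetti_map_cupPowTwo]
  have hresn : ∀ s, complexBetti.map (fiberι f s) (2 * n) (A n) =
      ((q n : ℚ) : ℂ) • cupPowTwo (complexBetti.map (fiberι f s) 2 H) n +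
        complexBetti.map (fiberι f s) (2 * n) W := by
    intro s
    rw [hAn, map_add, hres n s]
  -- the family of sections (fibre restrictions of the `A k`)
  let w : ∀ (k : ℕ) (s : ComplexPoints S), complexBetti (fiberOver f s) (2 * k) :=
    fun k s => complexBetti.map (fiberι f s) (2 * k) (A k)
  -- continuity: they ARE global sections
  have hwc : ∀ k, Continuous fun s => (⟨s, w k s⟩ : FiberClass f (2 * k)) := fun k =>
    continuous_globalSection f (2 * k) (A k)
  -- values in the locus of Hodge classes
  have hwH : ∀ k s, (⟨s, w k s⟩ : FiberClass f (2 * k)) ∈ locusOfHodgeClasses f (2 * n) k := by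
    intro k s
    rw [mem_locusOfHodgeClasses_iff]
    by_cases hkn : k = n
    · subst hkn
      show IsRationalClass (complexBetti.map (fiberι f s) (2 * k) (A k)) ∧
        IsOfHodgeType (2 * k) (fiberOver f s) (2 * k) k k (complexBetti.map (fiberι f s) (2 * k) (A k))
      rw [hresn s]
      refine ⟨?_, ?_⟩
      · exact (((hH s).1.cupPowTwo k).smul (q k)).add (hWrat s)
      · exact ((isOfHodgeType_cupPowTwo (hf.isSmoothProjective s) (hH s).2 k).smul _).add
          (hf.isSmoothProjective s) (hWH s)
    · show IsRationalClass (complexBetti.map (fiberι f s) (2 * k) (A k)) ∧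
        IsOfHodgeType (2 * n) (fiberOver f s) (2 * k) k k (complexBetti.map (fiberι f s) (2 * k) (A k))
      rw [hAk k hkn, hres k s]
      exact ⟨((hH s).1.cupPowTwo k).smul (q k),
        (isOfHodgeType_cupPowTwo (hf.isSmoothProjective s) (hH s).2 k).smul _⟩
  -- the values at `s₀` are the Chern character of `E₀`
  have hw₀ : ∀ k, w k s₀ = C.ch (fiberOver f s₀) E₀ k := by
    intro k
    by_cases hkn : k = n
    · subst hkn
      show complexBetti.map (fiberι f s₀) (2 * k) (A k) = _
      rw [hresn s₀, hn]
    · show complexBetti.map (fiberι f s₀) (2 * k) (A k) = _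
      rw [hAk k hkn, hres k s₀, hk k hkn]
  -- Perry
  have h := hP C f (2 * n) hf hSqp hint hS w hwc hwH s₀ E₀ hE₀ hsr hw₀ s n
  have h' : w n s = ((q n : ℚ) : ℂ) • cupPowTwo (complexBetti.map (fiberι f s) 2 H) n +
      complexBetti.map (fiberι f s) (2 * n) W := hresn s
  rwa [h'] at h

/-! ## The strong Weil plane of every hyperbolic `K`-Weil `2n`-fold, from ONE anchor object -/

/-- **Weil classes on EVERY hyperbolic `√-d`-Weil abelian `2n`-fold are algebraic, given ONE anchor object, Deligne's
hyperbolic family with reach, Perry's theorem (full semiregularity) and a standard Chern character** (the line's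
composition, every `n, d ≥ 1`; nothing is asserted — hypotheses `hO`, `hF`, `hP`, `hC`).  The anchor object `hO`
supplies the hyperbolic anchor `(P, ψ, e, a)` with its non-zero rational Weil class `w` and the semiregular `E₀` on any
fibre `≅ P.X`; Deligne's family through `P` (`hF`) carries `h(e, a)` as `H` and `w` as the section `σ`, globalised to
`W ∈ H^{2n}(𝒳)` by the landed W-engine and rational along `σ` (landed), and reaches the target `A` through a fibre
`A' ≅ 𝒳_{s₁}` by a `K`-isogeny `A → A'`; `engine_of_perry` makes `q_n·H_{s₁}^n + r·W_{s₁}` algebraic; `H_{s₁}^n` is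
algebraic (Lefschetz `(1,1)` on the abelian `A'`, discharged in the tree, and Kleiman); so `W_{s₁}` is a non-zero
algebraic class of the strong Weil plane of `A'` — ONE CLASS SUFFICES (unconditional) — and isogeny transfer returns to
`A`. [cite: Deligne1982HodgeCycles, proof of Thm. 4.8] [cite: Perry2026Semiregularity, Thm. 1.1 (2)]
[cite: vanGeemen1994HodgeAV, proof of Thm. 6.12] [cite: Markman2025SecantWeil, §1.5 and Thm. 1.5.1] -/
theorem weilClasses_algebraic_of_anchorObject (n d : ℕ) (hn : 1 ≤ n) (hd : 1 ≤ d)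
    (hO : ∃ (P : AbelianVariety ℂ) (ψ : P ⟶ P) (e : ProjectiveEmbedding P.X)
      (a : complexBetti (projectiveSpace e.n ℂ) 2) (w : complexBetti P.X (2 * n)),
      P.dim = 2 * n ∧ ψ ≫ ψ = -(d • 𝟙 P) ∧ IsRationalClass a ∧ a ≠ 0 ∧
      IsHyperbolicWeilType P ψ n
        ((d : ℂ) • complexBetti.map e.ι 2 a + complexBetti.map ψ.hom.hom.hom 2 (complexBetti.map e.ι 2 a)) ∧
      w ∈ weilClassesOf P ψ n d ∧ IsRationalClass w ∧ w ≠ 0 ∧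
      ∀ (F₀ : SchemeOver ℂ) (e₀ : P.X ≅ F₀) (C : StandardChernCharacterBetti),
        ∃ (E₀ : F₀.left.Modules) (hE₀ : IsFiniteLocallyFree E₀) (q : ℕ → ℚ) (r : ℚ), r ≠ 0 ∧
          IsISemiregular hE₀ Set.univ ∧
          (∀ k : ℕ, k ≠ n →
            C.ch F₀ E₀ k = ((q k : ℚ) : ℂ) • complexBetti.map e₀.inv (2 * k)
              (cupPowTwo ((d : ℂ) • complexBetti.map e.ι 2 a +
                complexBetti.map ψ.hom.hom.hom 2 (complexBetti.map e.ι 2 a)) k)) ∧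
          C.ch F₀ E₀ n = complexBetti.map e₀.inv (2 * n)
            (((q n : ℚ) : ℂ) • cupPowTwo ((d : ℂ) • complexBetti.map e.ι 2 a +
                complexBetti.map ψ.hom.hom.hom 2 (complexBetti.map e.ι 2 a)) n + ((r : ℚ) : ℂ) • w))
    (hF : weilFamilyReach_hyperbolic) (hP : Perry2026_semiregularFull_remainsAlgebraic)
    (hC : Nonempty StandardChernCharacterBetti)
    (A : AbelianVariety ℂ) (φ : A ⟶ A) (hA : A.dim = 2 * n) (hφ : φ ≫ φ = -(d • 𝟙 A))
    (eA : ProjectiveEmbedding A.X) (aA : complexBetti (projectiveSpace eA.n ℂ) 2) (haA : IsRationalClass aA)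
    (haA0 : aA ≠ 0)
    (hhypA : IsHyperbolicWeilType A φ n
      ((d : ℂ) • complexBetti.map eA.ι 2 aA + complexBetti.map φ.hom.hom.hom 2 (complexBetti.map eA.ι 2 aA))) :
    weilClassesOf A φ n d ≤ algebraicClasses A.X n := by
  -- `n = m + 1`
  obtain ⟨m, rfl⟩ : ∃ m, n = m + 1 := ⟨n - 1, by omega⟩
  -- the anchor object
  obtain ⟨P, ψ, e, a, w, hP8, hψ, ha, ha0, hhyp, hwW, hwrat, hw0, hobj⟩ := hO
  set h : complexBetti P.X 2 :=
    (d : ℂ) • complexBetti.map e.ι 2 a + complexBetti.map ψ.hom.hom.hom 2 (complexBetti.map e.ι 2 a) with hhdef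
  -- Deligne's family through the hyperbolic anchor `P`, section through `w`, reaching `A`
  obtain ⟨𝒳, S, f, s₀, s₁, e', A', φ', e₁, σ, H, hfam, hemb, hirr, hsm, hSqp, -, hHfib, hHs₀, hσc, hpt, hσH,
      hσ₀, hA'dim, hφ'A, ⟨u, v, m', hm', huv, hu, hv⟩, w₁, hσ₁, hw₁W, hw₁0⟩ :=
    hF (m + 1) d hn hd P ψ e a hP8 hψ ha ha0 hhyp w hwW hw0 A φ eA aA hA hφ haA haA0 hhypA
  -- the W-engine: `σ` is the restriction of a global class `W`
  obtain ⟨W, hWσ⟩ := stub_globalClassEngine f (2 * (m + 1)) (2 * (m + 1)) hfam hemb hsm hSqp hirr σ hσc hpt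
  have hcls : ∀ (s : ComplexPoints S) (y : complexBetti (fiberOver f s) (2 * (m + 1))),
      σ s = ⟨s, y⟩ → complexBetti.map (fiberι f s) (2 * (m + 1)) W = y := by
    intro s y hy
    have h := (hWσ s).symm.trans hy
    simp only [globalSection, FiberClass.mk.injEq, heq_eq_eq, true_and] at h
    exact h
  have hW₀ : complexBetti.map (fiberι f s₀) (2 * (m + 1)) W = complexBetti.map e'.inv (2 * (m + 1)) w :=
    hcls s₀ _ hσ₀
  have hW₁ : complexBetti.map (fiberι f s₁) (2 * (m + 1)) W = w₁ := hcls s₁ _ hσ₁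
  -- rationality along the section (landed), Hodge type along the section (the fact)
  have hrat₀ : IsRationalClass (σ s₀).cls := by rw [hσ₀]; exact hwrat.map _
  have hratσ : ∀ s, IsRationalClass (σ s).cls :=
    stub_rationalAlongSection f (2 * (m + 1)) (2 * (m + 1)) hfam hsm hSqp hirr σ hσc hpt s₀ hrat₀
  have hWrat : ∀ s, IsRationalClass (complexBetti.map (fiberι f s) (2 * (m + 1)) W) := by
    intro s
    have h := hratσ s
    rw [hWσ s] at h
    exact h
  have hWH : ∀ s, IsOfHodgeType (2 * (m + 1)) (fiberOver f s) (2 * (m + 1)) (m + 1) (m + 1)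
      (complexBetti.map (fiberι f s) (2 * (m + 1)) W) := by
    intro s
    have h := hσH s
    rw [hWσ s] at h
    exact h
  -- `H_{s₀} = e'^{-1*} h(e, a)`
  rw [← hhdef] at hHs₀
  have hH₀ : complexBetti.map (fiberι f s₀) 2 H = complexBetti.map e'.inv 2 h := by
    rw [← hHs₀, e'.complexBetti_map_inv_map_hom]
  -- the semiregular charged object on the fibre `𝒳_{s₀} ≅ P`
  obtain ⟨C⟩ := hC
  obtain ⟨E₀, hE₀, q, r, hr, hsr, hEk, hEn⟩ := hobj (fiberOver f s₀) e' C
  have hr' : ((r : ℚ) : ℂ) ≠ 0 := by exact_mod_cast hr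
  have hk : ∀ k : ℕ, k ≠ m + 1 →
      C.ch (fiberOver f s₀) E₀ k = ((q k : ℚ) : ℂ) • cupPowTwo (complexBetti.map (fiberι f s₀) 2 H) k := by
    intro k hk4
    rw [hEk k hk4, complexBetti_map_cupPowTwo, hH₀]
  -- the rescaled global Weil class `r • W` (rational `(n,n)` restrictions, like `W`)
  have hWrat' : ∀ s, IsRationalClass (complexBetti.map (fiberι f s) (2 * (m + 1)) (((r : ℚ) : ℂ) • W)) := by
    intro s
    rw [map_smul]
    exact (hWrat s).smul r
  have hWH' : ∀ s, IsOfHodgeType (2 * (m + 1)) (fiberOver f s) (2 * (m + 1)) (m + 1) (m + 1)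
      (complexBetti.map (fiberι f s) (2 * (m + 1)) (((r : ℚ) : ℂ) • W)) := by
    intro s
    rw [map_smul]
    exact (hWH s).smul _
  have hn' : C.ch (fiberOver f s₀) E₀ (m + 1) =
      ((q (m + 1) : ℚ) : ℂ) • cupPowTwo (complexBetti.map (fiberι f s₀) 2 H) (m + 1) +
        complexBetti.map (fiberι f s₀) (2 * (m + 1)) (((r : ℚ) : ℂ) • W) := by
    rw [hEn, map_add, map_smul, map_smul, complexBetti_map_cupPowTwo, hH₀, map_smul, hW₀]
  -- the engine: `q_n H_{s₁}^n + r • W_{s₁}` is algebraic on `𝒳_{s₁}`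
  have halg := engine_of_perry hP (m + 1) f hfam hirr hsm hSqp H hHfib (((r : ℚ) : ℂ) • W) hWrat' hWH' s₀
    C.toChernCharacterBetti E₀ hE₀ hsr q hk hn' s₁
  -- `H_{s₁}^n` is algebraic on `𝒳_{s₁}`: Lefschetz (1,1) + Kleiman on the abelian `A' ≅ 𝒳_{s₁}`
  have hA'sp : IsSmoothProjective (2 * (m + 1)) A'.X := by
    have h := AbelianVariety.isSmoothProjective_holds (A := A')
    rw [AbelianVariety.isSmoothProjective, hA'dim] at h
    exact h
  have hh₁rat : IsRationalClass (complexBetti.map e₁.hom 2 (complexBetti.map (fiberι f s₁) 2 H)) :=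
    (hHfib s₁).1.map _
  have hh₁H : IsOfHodgeType (2 * (m + 1)) A'.X 2 1 1 (complexBetti.map e₁.hom 2 (complexBetti.map (fiberι f s₁) 2 H)) :=
    (hHfib s₁).2.map_of_iso e₁
  have hh₁alg : complexBetti.map e₁.hom 2 (complexBetti.map (fiberι f s₁) 2 H) ∈ algebraicClasses A'.X 1 :=
    lefschetzOneOne_rational_holds hA'sp _ hh₁rat hh₁H
  have hh₁n : complexBetti.map e₁.hom (2 * (m + 1)) (cupPowTwo (complexBetti.map (fiberι f s₁) 2 H) (m + 1)) ∈
      algebraicClasses A'.X (m + 1) := by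
    rw [complexBetti_map_cupPowTwo]
    exact cupPowTwo_mem_algebraicClasses_abelian A' hh₁alg m
  have hHn : cupPowTwo (complexBetti.map (fiberι f s₁) 2 H) (m + 1) ∈ algebraicClasses (fiberOver f s₁) (m + 1) :=
    owf_isoTransport _ A' e₁ (m + 1) _ hh₁n
  -- hence `r • W_{s₁} = r • w₁`, and so `w₁` (`r ≠ 0`), is algebraic on `𝒳_{s₁}`
  have hrW₁alg : ((r : ℚ) : ℂ) • w₁ ∈ algebraicClasses (fiberOver f s₁) (m + 1) := by
    rw [← hW₁, ← map_smul]
    have h := Submodule.sub_mem _ halg (Submodule.smul_mem _ (((q (m + 1) : ℚ) : ℂ)) hHn)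
    rwa [add_sub_cancel_left] at h
  have hW₁alg : w₁ ∈ algebraicClasses (fiberOver f s₁) (m + 1) := by
    have h := Submodule.smul_mem _ (((r : ℚ) : ℂ)⁻¹) hrW₁alg
    rwa [inv_smul_smul₀ hr'] at h
  -- a NON-ZERO ALGEBRAIC class of the strong Weil plane of `A'`: one class suffices (unconditional)
  have hw₁alg : complexBetti.map e₁.hom (2 * (m + 1)) w₁ ∈ algebraicClasses A'.X (m + 1) :=
    Theorems.isoInvariance_proof e₁ (m + 1) _ hW₁alg
  have hA'alg : weilClassesOf A' φ' (m + 1) d ≤ algebraicClasses A'.X (m + 1) :=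
    (weilClassesOf_le_algebraicClasses_iff_exists_ne_zero_of_dim_eq abelianVarietyCohomologyExteriorH1_holds
      hA'dim (Nat.succ_pos m) hd hφ'A).mpr ⟨_, hw₁W, hw₁alg, hw₁0⟩
  -- isogeny transfer `A → A'` (landed)
  have hφℤ : φ ≫ φ = -((d : ℤ) • 𝟙 A) := by rw [hφ, natCast_zsmul]
  exact stub_isogenyTransfer d (m + 1) A A' φ φ' hA hA'dim hφℤ u v m' hm' huv hu hv hA'alg

/-! ## The crux at `(n, d) = (4, 7)` (BY NAME) -/

/-- **`HyperbolicEightfoldsSqrtMinus7` from ONE anchor object** (plus the named facts F, P and the construction C):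
the hypothesis `hO` is VERBATIM the registered stub `SecantAnchorObject47` of the line's skeleton v3 (a semiregular
Weil-charged finite locally free sheaf on one hyperbolic `√-7` abelian eightfold, in the crux's embedded typing
`h(e, a) = 7·ι^*a + ψ^*ι^*a`).  Given a hyperbolic `(A, φ, e_A, a_A)` and a rational `(4,4)` class `c` of the typed Weil
plane: `c` lies in the strong Weil plane (`stub_upgrade`, landed), which is algebraic by
`weilClasses_algebraic_of_anchorObject`.  Hyperbolicity of `A` is consumed by F's reach; the `(4,4)` clause is not
consumed (redundant given hyperbolicity, crux Disproof §3(d)). [cite: Markman2025SecantWeil, Thm. 1.5.1 and §1.2]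
[cite: Deligne1982HodgeCycles, proof of Thm. 4.8] [cite: Perry2026Semiregularity, Thm. 1.1 (2)] -/
theorem hyperbolicEightfoldsSqrtMinus7_of_anchorObject :
    (∃ (P : AbelianVariety ℂ) (ψ : P ⟶ P) (e : ProjectiveEmbedding P.X)
      (a : complexBetti (projectiveSpace e.n ℂ) 2) (w : complexBetti P.X (2 * 4)),
      P.dim = 2 * 4 ∧ ψ ≫ ψ = -((7 : ℤ) • 𝟙 P) ∧ IsRationalClass a ∧ a ≠ 0 ∧
      IsHyperbolicWeilType P ψ 4
        ((7 : ℂ) • complexBetti.map e.ι 2 a + complexBetti.map ψ.hom.hom.hom 2 (complexBetti.map e.ι 2 a)) ∧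
      w ∈ weilClassesOf P ψ 4 7 ∧ IsRationalClass w ∧ w ≠ 0 ∧
      ∀ (F₀ : SchemeOver ℂ) (e₀ : P.X ≅ F₀) (C : StandardChernCharacterBetti),
        ∃ (E₀ : F₀.left.Modules) (hE₀ : IsFiniteLocallyFree E₀) (q : ℕ → ℚ) (r : ℚ), r ≠ 0 ∧
          IsISemiregular hE₀ Set.univ ∧
          (∀ k : ℕ, k ≠ 4 →
            C.ch F₀ E₀ k = ((q k : ℚ) : ℂ) • complexBetti.map e₀.inv (2 * k)
              (cupPowTwo ((7 : ℂ) • complexBetti.map e.ι 2 a +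
                complexBetti.map ψ.hom.hom.hom 2 (complexBetti.map e.ι 2 a)) k)) ∧
          C.ch F₀ E₀ 4 = complexBetti.map e₀.inv (2 * 4)
            (((q 4 : ℚ) : ℂ) • cupPowTwo ((7 : ℂ) • complexBetti.map e.ι 2 a +
                complexBetti.map ψ.hom.hom.hom 2 (complexBetti.map e.ι 2 a)) 4 + ((r : ℚ) : ℂ) • w)) →
    weilFamilyReach_hyperbolic → Perry2026_semiregularFull_remainsAlgebraic →
    Nonempty StandardChernCharacterBetti →
    Summit.HodgeConjecture.HodgeConjecture.Theses.HeckePrymWeil.HyperbolicEightfoldsSqrtMinus7 := by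
  intro hO hF hP hC A φ hA hφ eA aA haA haA0 hhypA c _ _ hW
  have hA' : A.dim = 2 * 4 := hA
  have hcW : c ∈ weilClassesOf A φ 4 7 :=
    stub_upgrade 7 (by norm_num) (by norm_num) le_rfl 4 A φ hA' hφ hW
  -- casts: the general theorem is stated with `ℕ`-scalars `(d : ℂ)` and `d • 𝟙`
  have h7 : ((7 : ℕ) : ℂ) = (7 : ℂ) := Nat.cast_ofNat
  have hφ' : φ ≫ φ = -((7 : ℕ) • 𝟙 A) := by rw [hφ, ← natCast_zsmul]; rfl
  have hhypA' : IsHyperbolicWeilType A φ 4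
      (((7 : ℕ) : ℂ) • complexBetti.map eA.ι 2 aA +
        complexBetti.map φ.hom.hom.hom 2 (complexBetti.map eA.ι 2 aA)) := by
    rw [h7]; exact hhypA
  refine weilClasses_algebraic_of_anchorObject 4 7 (by norm_num) (by norm_num) ?_ hF hP hC A φ hA' hφ' eA aA
    haA haA0 hhypA' hcW
  obtain ⟨P, ψ, e, a, w, hP8, hψ, ha, ha0, hhyp, hwW, hwrat, hw0, hobj⟩ := hO
  refine ⟨P, ψ, e, a, w, hP8, ?_, ha, ha0, ?_, hwW, hwrat, hw0, ?_⟩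
  · rw [hψ, ← natCast_zsmul]; rfl
  · rw [h7]; exact hhyp
  · simpa only [h7] using hobj

end Summit.HodgeConjecture.HodgeConjecture.Theorems.HyperbolicEightfoldsSqrtMinus7.AnchorObject

end
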